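import Literature.AlgebraicGeometry.Motives.HodgeStructureEndAlgSemisimple
import Literature.AlgebraicGeometry.Motives.HodgeStructureAbelianCategory
import HarnessLib

/-!
# `End X` in the category of `ℚ`-Hodge structures of weight `n` is semisimple for polarizable `X`

Family `hodge`, layer `Literature/AlgebraicGeometry/Motives` (lane `lit-hodgefound`, B2-39 / B2-20 /
B66, TREE side). Rider of `Motives/HodgeStructureEndAlgSemisimple` (`End_{HS}(H) = H.endAlg` is a
semisimple ring for polarizable `H`), phrased for the BUNDLED category `HodgeStructureCat n` of the
tree (`Motives/HodgeStructureAbelianCategory`): the `ℚ`-algebra `End X` of an object `X` is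
identified with `X.str.endAlg` and is therefore semisimple — the half of Moonen's sentence that the
tree's `HodgeStructureCat.finite_hom` ("`End X` is a finite-dimensional `ℚ`-algebra — the finiteness
half") left open. THEOREMS plus one plumbing `def` with body (the algebra isomorphism); no notion,
no named fact (0 new facts).

Source read verbatim. B. Moonen, *Families of Motives and the Mumford–Tate Conjecture* (2017)
[Moonen2017FamiliesMotives] (held text `paper:doi-10-1007-s00032-017-0273-x`, p. 3 L9), §2.1: "If `H`
is a pure polarizable `ℚ`-Hodge structure, its endomorphism algebra `D = End_{HS_ℚ}(H)` is a finite
dimensional semisimple `ℚ`-algebra."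

## What is proved

* `HodgeStructureCat.endAlgEquivEnd X : X.str.endAlg ≃ₐ[ℚ] End X` — the subalgebra
  `End_{HS} ⊆ End_ℚ(V)` of the tree (`HodgeStructure.endAlg`, Huybrechts §3.3.3) IS the endomorphism
  algebra of `X` in `HodgeStructureCat n` (`a ↦ endAlg.toHom a`, inverse `f ↦ f.toLinearMap`).
* **`HodgeStructureCat.isSemisimpleRing_end`** — for `X` polarizable (finite-dimensional), `End X` is a
  semisimple ring (transport of `HodgeStructure.isSemisimpleRing_endAlg`).
-/

noncomputable section

namespace Literature.AlgebraicGeometry.Motives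

open CategoryTheory

universe u

namespace HodgeStructureCat

variable {n : ℤ}

/-- **`End_{HS}(H) = End X`**: the tree's subalgebra `X.str.endAlg ⊆ End_ℚ(X)` of endomorphisms
preserving the Hodge filtration is, as a `ℚ`-algebra, the endomorphism algebra of the object `X` of
`HodgeStructureCat n` (multiplication in `End X` is composition, `f * g = g ≫ f`).
[cite: Huybrechts2016K3, §3.3.3] [cite: Moonen2017FamiliesMotives, §2.1 (p. 3)] -/
def endAlgEquivEnd (X : HodgeStructureCat.{u} n) : X.str.endAlg ≃ₐ[ℚ] End X where
  toFun a := HodgeStructure.endAlg.toHom a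
  invFun f := ⟨f.toLinearMap, f.toLinearMap_mem_endAlg⟩
  left_inv _ := rfl
  right_inv _ := rfl
  map_mul' _ _ := hom_ext rfl
  map_add' _ _ := hom_ext rfl
  commutes' q := by
    refine hom_ext ?_
    change ((algebraMap ℚ X.str.endAlg q : X.str.endAlg) : Module.End ℚ X) =
      (algebraMap ℚ (End X) q).toLinearMap
    rw [Algebra.algebraMap_eq_smul_one, Algebra.algebraMap_eq_smul_one]
    rfl

/-- Underlying linear map of `endAlgEquivEnd X a`. [cite: Huybrechts2016K3, §3.3.3] -/
@[simp]
theorem endAlgEquivEnd_apply_toLinearMap (X : HodgeStructureCat.{u} n) (a : X.str.endAlg) :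
    (endAlgEquivEnd X a).toLinearMap = (a : Module.End ℚ X) :=
  rfl

/-- Underlying endomorphism of `(endAlgEquivEnd X).symm f`. [cite: Huybrechts2016K3, §3.3.3] -/
@[simp]
theorem coe_endAlgEquivEnd_symm_apply (X : HodgeStructureCat.{u} n) (f : End X) :
    (((endAlgEquivEnd X).symm f : X.str.endAlg) : Module.End ℚ X) = f.toLinearMap :=
  rfl

/-- **`End X` is a semisimple `ℚ`-algebra for a polarizable Hodge structure `X`** (Moonen §2.1:
"`D = End_{HS_ℚ}(H)` is a finite dimensional semisimple `ℚ`-algebra"; finite-dimensionality is the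
tree's `HodgeStructureCat.finite_hom`): transport of `HodgeStructure.isSemisimpleRing_endAlg` along
`endAlgEquivEnd`. [cite: Moonen2017FamiliesMotives, §2.1 (p. 3)] -/
theorem isSemisimpleRing_end (X : HodgeStructureCat.{u} n) [Module.Finite ℚ X]
    (hX : X.str.IsPolarizable) : IsSemisimpleRing (End X) :=
  haveI := HodgeStructure.isSemisimpleRing_endAlg hX
  (endAlgEquivEnd X).toRingEquiv.isSemisimpleRing

/-- The same for the object `of H` of a polarizable Hodge structure `H` on a finite-dimensional `V`.
[cite: Moonen2017FamiliesMotives, §2.1 (p. 3)] -/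
theorem isSemisimpleRing_end_of {V : Type u} [AddCommGroup V] [Module ℚ V] [Module.Finite ℚ V]
    {H : HodgeStructure V n} (hH : H.IsPolarizable) : IsSemisimpleRing (End (of H)) :=
  isSemisimpleRing_end (of H) hH

end HodgeStructureCat

end Literature.AlgebraicGeometry.Motives

end
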